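import Summits.ResolutionOfSingularities.ResolutionOfSingularities.Theorems.FrobeniusLadderFInjectiveMacaulayficationFDSpecimen
import Summits.ResolutionOfSingularities.ResolutionOfSingularities.Theorems.FrobeniusLadderFInjectiveMacaulayficationGoodSupportDominated
import HarnessLib

/-!
# `f′ = σ₅(f_P2d4C) = z² + x⁴z + x⁹ + x¹⁰ + y³ + u³ + t³` (char 2): the INPUT FACTS of the class row — prime, no variable vanishes, regular off the vertex, and
# ★ WEAKLY NON-DEGENERATE ALONG EVERY POSITIVE WEIGHT (the coordinate-dependent hypothesis that the shift `σ₅ : z ↦ z + x⁵` buys)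
# (crux `FInjectiveMacaulayfication` stmt-ResolutionOfSingularities-15315, chain w45a; (W-WND) class-route retro-fit PILOT, res-L1-w45a-plan-1 RULING R22.4 (3) / R22.2;
# seat res-L1-w45a-stub-2 g11; template = res-L1-w45a-stub-3 g11ʼs `FDSpecimen` §1 and `FDStorey2WND`; evidence-level twin = res-L1-w45a-tri-2 g19 `R222-WND-fprime-tri2.md`
# 882bb80633cda426: 47 compact faces, hWND 47/47)

[OURS · L1 W4.5a] Support file (`--supports stmt-ResolutionOfSingularities-15315 --as helper`); def-free, unconditional; replaces the role of NO printed item; NOT a statement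
of the manuscript; AI-written (AI review is weaker than expert review).

`X 0 = x`, `X 1 = y`, `X 2 = u`, `X 3 = t`, `X 4 = z`; `f′ = z² + x⁴z + x⁹ + x¹⁰ + y³ + u³ + t³ = f_P2d4C(x,y,u,t,z+x⁵)` (`f_P2d4C = z² + x⁴z + y³ + u³ + t³`, the census bed of
✓ p610550 / row #1), ANY field `k` of characteristic 2 unless stated.
* §1 `casts_char2`, `pderiv_zero_f` (`∂_x f′ = x⁸`), `pderiv_cube_f` (`∂_y,∂_u,∂_t f′ = y², u², t²`), `pderiv_four_f` (`∂_z f′ = x⁴`), `constantCoeff_f`, ★ `prime_f` (Eisenstein-type in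
  `T = z`: `T² + C(x⁴)T + C(c)`, `c = x⁹+x¹⁰+y³+u³+t³`, at `(x,y,u,t) = (0,0,1,1)`: `x⁴ = 0`, `c = 1+1 = 0`, `∂_u c = 3u² = 1 ≠ 0`), `regular_off_vertex` (= the class rows' `hreg`:
  Jacobian off `𝔪` with `x⁴, y², u², t²`; `z` alone cannot miss a prime containing `x,y,u,t`: `z² = f′ − …`), `isPrime_span_f`, `f_not_mem_span_X`, ★ `mk_X_ne_zero` (= `hXne`);
* §2 ★★ `weaklyNondegenerate` — `f′` is WEAKLY NON-DEGENERATE along every positive weight, by the «good support» criterion VERSION 2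
  (`CensusBedsWeaklyNondegenerate.weaklyNondegenerate_of_good_support'`, ✓ `GoodSupportDominated`): `β₀ = 2e_z`; `x⁴z` is good via `z` (exponent 1; even elsewhere), `x⁹` via `x`
  (9 odd; `4, 10` even elsewhere), `y³, u³, t³` in private variables, and `x¹⁰` is DOMINATED by `x⁹` (lies on no compact face). The census bed P2d4C itself is weakly non-degenerate too
  (✓ p656259 `weaklyNondegenerate_bed42`) but NOT convenient in `x`, so no `𝔪`-primary `Σ_f`-refining fan exists for it (R21.39 (1)); `f′` is convenient (`x⁹`).
[folklore mathematics, OURS as a certificate; cite: Hartshorne1977, I Thm. 5.1; BoubakriGreuelMarkwig2010, §3 (p. 10)]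
-/

-- single-problem summit: the doubled namespace component is forced
set_option linter.dupNamespace false

noncomputable section

open AlgebraicGeometry CategoryTheory Literature.AlgebraicGeometry.Resolution TopologicalSpace IsLocalRing MvPolynomial

namespace Summit.ResolutionOfSingularities.ResolutionOfSingularities.Theorems.FInjectiveMacaulayfication.Sigma5P2d4CSpecimen

open Summit.ResolutionOfSingularities.ResolutionOfSingularities.Theorems.FInjectiveMacaulayfication
open Literature.AlgebraicGeometry.Resolution.BoubakriGreuelMarkwig

/-! ## §1 Derivatives, primality, regularity off the vertex, no variable vanishes -/

/-- In characteristic `2`: `3 = 1`, `4 = 0`, `9 = 1`, `10 = 0` in `k[X]`. [folklore] -/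
theorem casts_char2 (k : Type) [Field k] [CharP k 2] :
    (3 : MvPolynomial (Fin 5) k) = 1 ∧ (4 : MvPolynomial (Fin 5) k) = 0 ∧ (9 : MvPolynomial (Fin 5) k) = 1 ∧ (10 : MvPolynomial (Fin 5) k) = 0 := by
  have h2 : (2 : MvPolynomial (Fin 5) k) = 0 := (FermatCubicConeChar2.two_three k (n := 5)).1
  refine ⟨?_, ?_, ?_, ?_⟩
  · calc (3 : MvPolynomial (Fin 5) k) = 2 + 1 := by norm_num
      _ = 1 := by rw [h2]; ring
  · calc (4 : MvPolynomial (Fin 5) k) = 2 * 2 := by norm_num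
      _ = 0 := by rw [h2]; ring
  · calc (9 : MvPolynomial (Fin 5) k) = 2 * 4 + 1 := by norm_num
      _ = 1 := by rw [h2]; ring
  · calc (10 : MvPolynomial (Fin 5) k) = 2 * 5 := by norm_num
      _ = 0 := by rw [h2]; ring

/-- `∂f′/∂x = 4x³z + 9x⁸ + 10x⁹ = x⁸` in characteristic 2. [folklore] -/
theorem pderiv_zero_f (k : Type) [Field k] [CharP k 2] (f : MvPolynomial (Fin 5) k)
    (hf : f = X 4 ^ 2 + X 0 ^ 4 * X 4 + X 0 ^ 9 + X 0 ^ 10 + X 1 ^ 3 + X 2 ^ 3 + X 3 ^ 3) : pderiv 0 f = X 0 ^ 8 := by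
  obtain ⟨-, h4, h9, h10⟩ := casts_char2 k
  rw [hf]
  simp only [map_add, Derivation.leibniz, pderiv_pow, pderiv_X_self, pderiv_X_of_ne (show (4 : Fin 5) ≠ 0 by decide),
    pderiv_X_of_ne (show (1 : Fin 5) ≠ 0 by decide), pderiv_X_of_ne (show (2 : Fin 5) ≠ 0 by decide),
    pderiv_X_of_ne (show (3 : Fin 5) ≠ 0 by decide), smul_eq_mul, mul_zero, mul_one, add_zero, zero_add]
  push_cast
  rw [h4, h9, h10]
  ring

/-- `∂f′/∂y = y²`, `∂f′/∂u = u²`, `∂f′/∂t = t²` in characteristic 2. [folklore] -/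
theorem pderiv_cube_f (k : Type) [Field k] [CharP k 2] (f : MvPolynomial (Fin 5) k)
    (hf : f = X 4 ^ 2 + X 0 ^ 4 * X 4 + X 0 ^ 9 + X 0 ^ 10 + X 1 ^ 3 + X 2 ^ 3 + X 3 ^ 3) (j : Fin 5) (hj : j = 1 ∨ j = 2 ∨ j = 3) :
    pderiv j f = X j ^ 2 := by
  obtain ⟨h3, -, -, -⟩ := casts_char2 k
  rw [hf]
  rcases hj with rfl | rfl | rfl
  all_goals
    simp only [map_add, Derivation.leibniz, pderiv_pow, pderiv_X_self, smul_eq_mul, pderiv_X_of_ne (show (4 : Fin 5) ≠ 1 by decide),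
      pderiv_X_of_ne (show (0 : Fin 5) ≠ 1 by decide), pderiv_X_of_ne (show (2 : Fin 5) ≠ 1 by decide),
      pderiv_X_of_ne (show (3 : Fin 5) ≠ 1 by decide), pderiv_X_of_ne (show (4 : Fin 5) ≠ 2 by decide),
      pderiv_X_of_ne (show (0 : Fin 5) ≠ 2 by decide), pderiv_X_of_ne (show (1 : Fin 5) ≠ 2 by decide),
      pderiv_X_of_ne (show (3 : Fin 5) ≠ 2 by decide), pderiv_X_of_ne (show (4 : Fin 5) ≠ 3 by decide),
      pderiv_X_of_ne (show (0 : Fin 5) ≠ 3 by decide), pderiv_X_of_ne (show (1 : Fin 5) ≠ 3 by decide),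
      pderiv_X_of_ne (show (2 : Fin 5) ≠ 3 by decide), mul_zero, mul_one, zero_add, add_zero]
    push_cast
    rw [h3]
    ring

/-- `∂f′/∂z = 2z + x⁴ = x⁴` in characteristic 2. [folklore] -/
theorem pderiv_four_f (k : Type) [Field k] [CharP k 2] (f : MvPolynomial (Fin 5) k)
    (hf : f = X 4 ^ 2 + X 0 ^ 4 * X 4 + X 0 ^ 9 + X 0 ^ 10 + X 1 ^ 3 + X 2 ^ 3 + X 3 ^ 3) : pderiv 4 f = X 0 ^ 4 := by
  have h2 : (2 : MvPolynomial (Fin 5) k) = 0 := (FermatCubicConeChar2.two_three k (n := 5)).1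
  rw [hf]
  simp only [map_add, Derivation.leibniz, pderiv_pow, pderiv_X_self, smul_eq_mul, pderiv_X_of_ne (show (0 : Fin 5) ≠ 4 by decide),
    pderiv_X_of_ne (show (1 : Fin 5) ≠ 4 by decide), pderiv_X_of_ne (show (2 : Fin 5) ≠ 4 by decide),
    pderiv_X_of_ne (show (3 : Fin 5) ≠ 4 by decide), mul_zero, mul_one, add_zero]
  push_cast
  rw [h2]
  ring

/-- `f′` has no constant term. [folklore] -/
theorem constantCoeff_f (k : Type) [Field k] (f : MvPolynomial (Fin 5) k)
    (hf : f = X 4 ^ 2 + X 0 ^ 4 * X 4 + X 0 ^ 9 + X 0 ^ 10 + X 1 ^ 3 + X 2 ^ 3 + X 3 ^ 3) : constantCoeff f = 0 := by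
  rw [hf]
  simp [constantCoeff_X]

/-- ★ **`f′` is PRIME** (any field of characteristic 2): as `T² + C(x⁴)·T + C(c)` in `T = z` over `k[x,y,u,t]`, `c = x⁹ + x¹⁰ + y³ + u³ + t³`, Eisenstein-type at
`(x,y,u,t) = (0,0,1,1)` where `x⁴ = 0`, `c = 1 + 1 = 0` and `∂_u c = 3u² = 1 ≠ 0`. [folklore] -/
theorem prime_f (k : Type) [Field k] [CharP k 2] (f : MvPolynomial (Fin 5) k)
    (hf : f = X 4 ^ 2 + X 0 ^ 4 * X 4 + X 0 ^ 9 + X 0 ^ 10 + X 1 ^ 3 + X 2 ^ 3 + X 3 ^ 3) : Prime f := by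
  set e : MvPolynomial (Fin 5) k ≃+* Polynomial (MvPolynomial (Fin 4) k) :=
    ((renameEquiv k (_root_.finRotate 5)).trans (finSuccEquiv k 4)).toRingEquiv with he_def
  have hrot4 : (_root_.finRotate 5) (4 : Fin 5) = 0 := by decide
  have hrot : ∀ j : Fin 4, (_root_.finRotate 5) (Fin.castSucc j) = j.succ := by decide
  have he4 : e (X 4) = Polynomial.X := by
    show finSuccEquiv k 4 (rename _ (X 4)) = _
    rw [rename_X, hrot4]; exact finSuccEquiv_X_zero
  have hej : ∀ j : Fin 4, e (X (Fin.castSucc j)) = Polynomial.C (X j) := fun j => by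
    show finSuccEquiv k 4 (rename _ (X (Fin.castSucc j))) = _
    rw [rename_X, hrot j]; exact finSuccEquiv_X_succ (j := j)
  set b : MvPolynomial (Fin 4) k := X 0 ^ 4 with hb
  set c : MvPolynomial (Fin 4) k := X 0 ^ 9 + X 0 ^ 10 + X 1 ^ 3 + X 2 ^ 3 + X 3 ^ 3 with hc
  have hef : e f = Polynomial.X ^ 2 + Polynomial.C b * Polynomial.X + Polynomial.C c := by
    rw [hf, map_add, map_add, map_add, map_add, map_add, map_add, map_pow, map_mul, map_pow, map_pow, map_pow, map_pow, map_pow, map_pow, he4,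
      show (0 : Fin 5) = Fin.castSucc (0 : Fin 4) from rfl, show (1 : Fin 5) = Fin.castSucc (1 : Fin 4) from rfl,
      show (2 : Fin 5) = Fin.castSucc (2 : Fin 4) from rfl, show (3 : Fin 5) = Fin.castSucc (3 : Fin 4) from rfl, hej, hej, hej, hej, hb, hc]
    simp only [map_add, map_pow]
    ring
  set a : Fin 4 → k := ![0, 0, 1, 1] with ha
  have h2 : (2 : k) = 0 := by simpa using CharP.cast_eq_zero k 2
  have h3 : (3 : k) = 1 := by
    calc (3 : k) = 2 + 1 := by norm_num
      _ = 1 := by rw [h2]; ring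
  have hba : MvPolynomial.eval a b = 0 := by
    rw [hb, map_pow, eval_X, ha]
    simp
  have hca : MvPolynomial.eval a c = 0 := by
    rw [hc]
    simp only [map_add, map_pow, eval_X, ha, Matrix.cons_val_zero, Matrix.cons_val_one]
    simp only [Matrix.cons_val, one_pow, zero_pow (by norm_num : (9 : ℕ) ≠ 0), zero_pow (by norm_num : (10 : ℕ) ≠ 0), zero_pow (by norm_num : (3 : ℕ) ≠ 0),
      add_zero, zero_add]
    rw [show (1 : k) + 1 = 2 by norm_num, h2]
  have hder : MvPolynomial.eval a (pderiv 2 c) ≠ 0 := by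
    have e1 : pderiv 2 c = 3 * X 2 ^ 2 := by
      rw [hc]
      simp only [map_add, pderiv_pow, pderiv_X_self, pderiv_X_of_ne (show (1 : Fin 4) ≠ 2 by decide),
        pderiv_X_of_ne (show (0 : Fin 4) ≠ 2 by decide), pderiv_X_of_ne (show (3 : Fin 4) ≠ 2 by decide), mul_zero, zero_add, add_zero, mul_one]
      push_cast
      ring
    rw [e1, map_mul, map_pow, eval_X, ha]
    simp only [Matrix.cons_val]
    rw [map_ofNat, h3]
    simp
  have hirr : Irreducible (e f) := by
    rw [hef]
    exact Literature.AlgebraicGeometry.Motives.SmoothHypersurface.irreducible_X_pow_add_C_mul_X_add_C (d := 2) le_rfl b c a hba hca 2 hder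
  exact (MulEquiv.prime_iff e).mp hirr.prime

/-- ★ **`(k[X]/(f′))_P` is regular at every prime `P ⊉ (x̄, ȳ, ū, t̄, z̄)`** (= the class rows' `hreg`): some variable other than `z` misses `P` (`z² = f′ − x⁴z − x⁹ − x¹⁰ − y³ − u³ − t³`),
and then the partial `x⁴` (`∂_z`), `y²`, `u²` or `t²` misses `P` (Jacobian criterion). [cite: Hartshorne1977, I Thm. 5.1] -/
theorem regular_off_vertex (k : Type) [Field k] [CharP k 2] (f : MvPolynomial (Fin 5) k)
    (hf : f = X 4 ^ 2 + X 0 ^ 4 * X 4 + X 0 ^ 9 + X 0 ^ 10 + X 1 ^ 3 + X 2 ^ 3 + X 3 ^ 3)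
    (P : Ideal (MvPolynomial (Fin 5) k ⧸ Ideal.span {f})) [P.IsPrime]
    (hP : ¬ Ideal.span (Set.range fun j : Fin 5 => Ideal.Quotient.mk (Ideal.span {f}) (X j)) ≤ P) :
    IsRegularLocalRing (Localization.AtPrime P) := by
  have hP' : (P.comap (Ideal.Quotient.mk (Ideal.span {f}))).IsPrime := Ideal.comap_isPrime _ _
  set P' := P.comap (Ideal.Quotient.mk (Ideal.span {f})) with hP'def
  have hex : ∃ j : Fin 5, j ≠ 4 ∧ (X j : MvPolynomial (Fin 5) k) ∉ P' := by
    by_contra hall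
    push Not at hall
    apply hP
    rw [Ideal.span_le]
    rintro _ ⟨j, rfl⟩
    change X j ∈ P'
    by_cases hj : j = 4
    · subst hj
      have hfP : f ∈ P' := FermatCubicConeChar2.self_mem_comap f P
      have hx : (X 0 : MvPolynomial (Fin 5) k) ∈ P' := hall 0 (by decide)
      have hy : (X 1 : MvPolynomial (Fin 5) k) ∈ P' := hall 1 (by decide)
      have hu : (X 2 : MvPolynomial (Fin 5) k) ∈ P' := hall 2 (by decide)
      have ht : (X 3 : MvPolynomial (Fin 5) k) ∈ P' := hall 3 (by decide)
      have hz2 : (X 4 : MvPolynomial (Fin 5) k) ^ 2 ∈ P' := by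
        have e : (X 4 : MvPolynomial (Fin 5) k) ^ 2 = f - (X 0 ^ 4 * X 4 + X 0 ^ 9 + X 0 ^ 10 + X 1 ^ 3 + X 2 ^ 3 + X 3 ^ 3) := by rw [hf]; ring
        rw [e]
        refine Ideal.sub_mem _ hfP (Ideal.add_mem _ (Ideal.add_mem _ (Ideal.add_mem _ (Ideal.add_mem _ (Ideal.add_mem _ ?_ ?_) ?_) ?_) ?_) ?_)
        · exact Ideal.mul_mem_right _ _ (Ideal.pow_mem_of_mem _ hx 4 (by norm_num))
        · exact Ideal.pow_mem_of_mem _ hx 9 (by norm_num)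
        · exact Ideal.pow_mem_of_mem _ hx 10 (by norm_num)
        · exact Ideal.pow_mem_of_mem _ hy 3 (by norm_num)
        · exact Ideal.pow_mem_of_mem _ hu 3 (by norm_num)
        · exact Ideal.pow_mem_of_mem _ ht 3 (by norm_num)
      exact hP'.mem_of_pow_mem 2 hz2
    · exact hall j hj
  obtain ⟨j, hj4, hj⟩ := hex
  by_cases hj0 : j = 0
  · subst hj0
    exact HypersurfaceRegular.stub_hypersurfaceRegularOfPderiv k 5 f 4 P
      (by rw [pderiv_four_f k f hf]; exact fun h => hj (hP'.mem_of_pow_mem 4 h))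
  · have hj123 : j = 1 ∨ j = 2 ∨ j = 3 := by
      fin_cases j <;> simp_all
    exact HypersurfaceRegular.stub_hypersurfaceRegularOfPderiv k 5 f j P
      (by rw [pderiv_cube_f k f hf j hj123]; exact fun h => hj (hP'.mem_of_pow_mem 2 h))

/-- `(f′)` is a prime ideal. [plumbing] -/
theorem isPrime_span_f (k : Type) [Field k] [CharP k 2] (f : MvPolynomial (Fin 5) k)
    (hf : f = X 4 ^ 2 + X 0 ^ 4 * X 4 + X 0 ^ 9 + X 0 ^ 10 + X 1 ^ 3 + X 2 ^ 3 + X 3 ^ 3) : (Ideal.span {f}).IsPrime :=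
  (Ideal.span_singleton_prime (prime_f k f hf).ne_zero).mpr (prime_f k f hf)

/-- `f′ ∉ (Xᵢ)` for every `i`: evaluate at a coordinate point with `Xᵢ = 0` where `f′ = 1` (`e_y`, resp. `e_u` for `i = y`). [folklore] -/
theorem f_not_mem_span_X (k : Type) [Field k] (f : MvPolynomial (Fin 5) k) (hf : f = X 4 ^ 2 + X 0 ^ 4 * X 4 + X 0 ^ 9 + X 0 ^ 10 + X 1 ^ 3 + X 2 ^ 3 + X 3 ^ 3) :
    ∀ i : Fin 5, f ∉ Ideal.span {(X i : MvPolynomial (Fin 5) k)} := by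
  intro i h
  rw [Ideal.mem_span_singleton] at h
  obtain ⟨c, hc⟩ := h
  by_cases hi : i = 1
  · subst hi
    have := congrArg (MvPolynomial.eval (Pi.single 2 1 : Fin 5 → k)) hc
    rw [hf] at this
    simp at this
  · have := congrArg (MvPolynomial.eval (Pi.single 1 1 : Fin 5 → k)) hc
    rw [hf] at this
    have h1 : (Pi.single 1 1 : Fin 5 → k) i = 0 := by rw [Pi.single_apply, if_neg hi]
    simp [h1] at this

/-- ★ **No variable vanishes in `k[X]/(f′)`** (the class rows' binder `hXne`). [plumbing] -/
theorem mk_X_ne_zero (k : Type) [Field k] [CharP k 2] (f : MvPolynomial (Fin 5) k) (hf : f = X 4 ^ 2 + X 0 ^ 4 * X 4 + X 0 ^ 9 + X 0 ^ 10 + X 1 ^ 3 + X 2 ^ 3 + X 3 ^ 3)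
    (i : Fin 5) : Ideal.Quotient.mk (Ideal.span {f}) (X i) ≠ 0 := fun h0 =>
  PrimeTransfer.X_not_mem_span_of_isPrime (isPrime_span_f k f hf) (f_not_mem_span_X k f hf i) (Ideal.Quotient.eq_zero_iff_mem.mp h0)

/-! ## §2 ★★ Weak non-degeneracy along every positive weight -/

/-- The support of `f′`: every exponent is one of `2e_z, 4e_x + e_z, 9e_x, 10e_x, 3e_y, 3e_u, 3e_t` (as `Finsupp.single`s). [folklore] -/
theorem support_subset (k : Type) [Field k] (f : MvPolynomial (Fin 5) k) (hf : f = X 4 ^ 2 + X 0 ^ 4 * X 4 + X 0 ^ 9 + X 0 ^ 10 + X 1 ^ 3 + X 2 ^ 3 + X 3 ^ 3) :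
    ∀ α ∈ f.support, α = Finsupp.single 4 2 ∨ α = Finsupp.single 0 4 + Finsupp.single 4 1 ∨ α = Finsupp.single 0 9 ∨ α = Finsupp.single 0 10 ∨
      α = Finsupp.single 1 3 ∨ α = Finsupp.single 2 3 ∨ α = Finsupp.single 3 3 := by
  classical
  have hf' : f = monomial (Finsupp.single 4 2) 1 + monomial (Finsupp.single 0 4 + Finsupp.single 4 1) 1 + monomial (Finsupp.single 0 9) 1 +
      monomial (Finsupp.single 0 10) 1 + monomial (Finsupp.single 1 3) 1 + monomial (Finsupp.single 2 3) 1 + monomial (Finsupp.single 3 3) 1 := by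
    rw [hf]; simp only [X_pow_eq_monomial]; rw [X, monomial_mul, mul_one]
  intro α hα
  rw [hf'] at hα
  rcases Finset.mem_union.mp (support_add hα) with h | h
  · rcases CensusBedsWeaklyNondegenerate.mem_support_add6 h with h | h | h | h | h | h
    · exact Or.inl (CensusBedsWeaklyNondegenerate.eq_of_mem_support_monomial h)
    · exact Or.inr (Or.inl (CensusBedsWeaklyNondegenerate.eq_of_mem_support_monomial h))
    · exact Or.inr (Or.inr (Or.inl (CensusBedsWeaklyNondegenerate.eq_of_mem_support_monomial h)))
    · exact Or.inr (Or.inr (Or.inr (Or.inl (CensusBedsWeaklyNondegenerate.eq_of_mem_support_monomial h))))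
    · exact Or.inr (Or.inr (Or.inr (Or.inr (Or.inl (CensusBedsWeaklyNondegenerate.eq_of_mem_support_monomial h)))))
    · exact Or.inr (Or.inr (Or.inr (Or.inr (Or.inr (Or.inl (CensusBedsWeaklyNondegenerate.eq_of_mem_support_monomial h))))))
  · exact Or.inr (Or.inr (Or.inr (Or.inr (Or.inr (Or.inr (CensusBedsWeaklyNondegenerate.eq_of_mem_support_monomial h))))))

/-- The vertex `x⁹` IS in the support of `f′` (it dominates `x¹⁰`). [folklore] -/
theorem single_nine_mem_support (k : Type) [Field k] (f : MvPolynomial (Fin 5) k) (hf : f = X 4 ^ 2 + X 0 ^ 4 * X 4 + X 0 ^ 9 + X 0 ^ 10 + X 1 ^ 3 + X 2 ^ 3 + X 3 ^ 3) :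
    Finsupp.single (0 : Fin 5) 9 ∈ f.support := by
  classical
  rw [mem_support_iff, hf]
  have hmix : (X 0 : MvPolynomial (Fin 5) k) ^ 4 * X 4 = monomial (Finsupp.single 0 4 + Finsupp.single 4 1) 1 := by
    rw [X_pow_eq_monomial, X, monomial_mul, mul_one]
  have hne : Finsupp.single (0 : Fin 5) 4 + Finsupp.single 4 1 ≠ Finsupp.single 0 9 := fun h => by
    have := DFunLike.congr_fun h 0; simp at this
  simp only [coeff_add, coeff_X_pow, hmix, coeff_monomial, Finsupp.single_eq_single_iff, if_neg hne]
  norm_num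

/-- ★★ **`f′ = z² + x⁴z + x⁹ + x¹⁰ + y³ + u³ + t³` (char 2) IS WEAKLY NON-DEGENERATE ALONG EVERY POSITIVE WEIGHT** (good support, version 2: `β₀ = 2e_z`; `x⁴z` good via `z`,
`x⁹` via `x`, `y³, u³, t³` in private variables; `x¹⁰` dominated by `x⁹`). The kernel twin of res-L1-w45a-tri-2ʼs 47/47 face certificate (R22.2 break-test PASS).
[OURS · elementary certificate; cite: BoubakriGreuelMarkwig2010, §3 (p. 10)] -/
theorem weaklyNondegenerate (k : Type) [Field k] [CharP k 2] (f : MvPolynomial (Fin 5) k)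
    (hf : f = X 4 ^ 2 + X 0 ^ 4 * X 4 + X 0 ^ 9 + X 0 ^ 10 + X 1 ^ 3 + X 2 ^ 3 + X 3 ^ 3) :
    ∀ w : Fin 5 → ℝ, (∀ i, 0 < w i) → IsWeaklyNondegenerateAlong w (f : MvPowerSeries (Fin 5) k) := by
  classical
  have hsupp := support_subset k f hf
  have h9 := single_nine_mem_support k f hf
  have h2 : (2 : k) = 0 := by simpa using CensusBedsWeaklyNondegenerate.natCast_eq_zero_of_dvd (k := k) 2 2 dvd_rfl
  have h3 : ((3 : ℕ) : k) ≠ 0 := CensusBedsWeaklyNondegenerate.natCast_ne_zero_of_not_dvd 2 3 (by norm_num)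
  have h9k : ((9 : ℕ) : k) ≠ 0 := CensusBedsWeaklyNondegenerate.natCast_ne_zero_of_not_dvd 2 9 (by norm_num)
  have h4 : (4 : k) = 0 := by simpa using CensusBedsWeaklyNondegenerate.natCast_eq_zero_of_dvd (k := k) 2 4 (by norm_num)
  have h10 : (10 : k) = 0 := by simpa using CensusBedsWeaklyNondegenerate.natCast_eq_zero_of_dvd (k := k) 2 10 (by norm_num)
  have dom10 : ∃ γ ∈ f.support, γ ≤ (Finsupp.single 0 10 : Fin 5 →₀ ℕ) ∧ γ ≠ Finsupp.single 0 10 :=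
    ⟨_, h9, fun j => by fin_cases j <;> simp, fun h => by have := DFunLike.congr_fun h 0; simp at this⟩
  refine CensusBedsWeaklyNondegenerate.weaklyNondegenerate_of_good_support' f (prime_f k f hf).ne_zero (Finsupp.single 4 2) (fun α hα hne => ?_)
  rcases hsupp α hα with rfl | rfl | rfl | rfl | rfl | rfl | rfl
  · exact (hne rfl).elim
  · refine Or.inr ⟨4, by simp, fun β hβ hβne => ?_⟩
    rcases hsupp β hβ with rfl | rfl | rfl | rfl | rfl | rfl | rfl
    · exact Or.inl (by simp [h2])
    · exact (hβne rfl).elim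
    · exact Or.inl (by simp)
    · exact Or.inl (by simp)
    · exact Or.inl (by simp)
    · exact Or.inl (by simp)
    · exact Or.inl (by simp)
  · refine Or.inr ⟨0, by simpa using h9k, fun β hβ hβne => ?_⟩
    rcases hsupp β hβ with rfl | rfl | rfl | rfl | rfl | rfl | rfl
    · exact Or.inl (by simp)
    · exact Or.inl (by simp [h4])
    · exact (hβne rfl).elim
    · exact Or.inr dom10
    · exact Or.inl (by simp)
    · exact Or.inl (by simp)
    · exact Or.inl (by simp)
  · exact Or.inl dom10
  · refine Or.inr ⟨1, by simpa using h3, fun β hβ hβne => ?_⟩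
    rcases hsupp β hβ with rfl | rfl | rfl | rfl | rfl | rfl | rfl
    · exact Or.inl (by simp)
    · exact Or.inl (by simp)
    · exact Or.inl (by simp)
    · exact Or.inl (by simp)
    · exact (hβne rfl).elim
    · exact Or.inl (by simp)
    · exact Or.inl (by simp)
  · refine Or.inr ⟨2, by simpa using h3, fun β hβ hβne => ?_⟩
    rcases hsupp β hβ with rfl | rfl | rfl | rfl | rfl | rfl | rfl
    · exact Or.inl (by simp)
    · exact Or.inl (by simp)
    · exact Or.inl (by simp)
    · exact Or.inl (by simp)
    · exact Or.inl (by simp)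
    · exact (hβne rfl).elim
    · exact Or.inl (by simp)
  · refine Or.inr ⟨3, by simpa using h3, fun β hβ hβne => ?_⟩
    rcases hsupp β hβ with rfl | rfl | rfl | rfl | rfl | rfl | rfl
    · exact Or.inl (by simp)
    · exact Or.inl (by simp)
    · exact Or.inl (by simp)
    · exact Or.inl (by simp)
    · exact Or.inl (by simp)
    · exact Or.inl (by simp)
    · exact (hβne rfl).elim

end Summit.ResolutionOfSingularities.ResolutionOfSingularities.Theorems.FInjectiveMacaulayfication.Sigma5P2d4CSpecimen

end
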